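import Mathlib
import Summits.NavierStokesRegularity.NavierStokesRegularity.Theorems.FilamentSkeletonRssSelectionBoxRJRungContShooting
import Summits.NavierStokesRegularity.NavierStokesRegularity.Theorems.FilamentSkeletonRssSelectionBoxRJRungPicardMap
import Summits.NavierStokesRegularity.NavierStokesRegularity.Theorems.FilamentSkeletonRssSelectionBoxRJRungPicardStability
import Summits.NavierStokesRegularity.NavierStokesRegularity.Theorems.FilamentSkeletonRssSelectionBoxRJRungPicardForcingLip

/-!
# Route `FilamentSkeletonRss` · crux `SelectionBoxRJ` (stmt-NavierStokesRegularity-21220) — RUNG 2 (existence half):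
# the cut-off local-induction `R_π`-pair with the TRUE partner field exists for all large `Γ` (nonlocal fixed point)

Lane `ns-filament-19175-p1` (g7); helper file `--supports stmt-NavierStokesRegularity-21220`, route-independent.

THE STEP FROM R1 TO R2.  Rung 1 (`…RungModelArc`) froze the partner's field at its rung-0 values.  Here the partner of the
arc `x` is its OWN `R_π`-image and its field is the box's regularised Biot–Savart integral of that image, evaluated at the
moving point: `x` solves
`x″(t) = η χ(t) · x′(t) × ( V(x t) + (Γ·4/(4π)) ∫ ((‖x t − R_π x σ‖² + 1)^{3/2})⁻¹ • ((R_π∘x)′σ × (x t − R_π x σ)) dσ )`,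
`x(0) = P`, `x′(0) = e` — a NONLOCAL equation (the forcing depends on the whole curve).  `truePartnerArc_exists` constructs it
for every `0 < Rb ≤ 1/500`, `Γ ≥ exp(Rb⁻²)`, `0 < η ≤ 7/(Γ log Γ)`, together with: unit speed, tangent within `1/3000` of
`e` on `ℝ`, curvature `‖x″‖√Γ ≤ 1`, straight arms beyond `(6/5)Rb√(Γ log Γ)`.

PROOF = Banach's fixed point theorem on the closed set `S = {T : ℝ →ᵇ ℝ³ | ‖T t‖ = 1, ‖T t − e‖ ≤ 1/3000}` of bounded
continuous UNIT TANGENT FIELDS: `Φ(T) = (x_T)′` where `z_T = P + ∫₀ T`, the forcing is the true field of `R_π ∘ z_T` frozen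
along `z_T` (continuous: `partnerForcing_continuous`; bounded by `(17/10)√Γ`: `partnerForcing_norm_le`), and `x_T` is THE
cut-off local-induction arc with that forcing (`cutoffLia_exists_cont`).  `Φ(S) ⊆ S` by the Γ-uniform bending budget
(`cutoff_bending_le`, `picard_constants`); `Φ` is a contraction with constant `72 η S₂ √Γ = O(Rb²) ≤ 1/2`
(`partnerForcing_lipschitz`: forcing moves by `≤ 36δ√Γ`; `cutoff_tangent_stability`: tangent moves by `≤ 2ηS₂·` that).  At the
fixed point `x_T′ = T`, so `z_T = x_T` (fundamental theorem of calculus) and the frozen forcing IS the true partner forcing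
along `x_T`.

HONEST FRAMING.  R2 keeps the self-induction modelled by local induction (cut off outside `(6/5)×` the ball); only the
partner interaction is now the true one.  NOT an instance of `SelectionBoxRJ`; nothing here is a claim about Navier–Stokes
regularity or blow-up.
-/

set_option linter.dupNamespace false -- `Theorems.…Theorems`-style path/namespace repetition is the tree convention

noncomputable section

namespace Summit.NavierStokesRegularity.NavierStokesRegularity.Theorems

open Set Function Filter MeasureTheory Real Metric
open Literature.Analysis.FluidPDE
open scoped InnerProductSpace Topology NNReal BoundedContinuousFunction

namespace SelectionBoxRJRung

/-- **Constants of the Picard scheme.**  For `0 < Rb ≤ 1/500`, `Γ ≥ exp(Rb⁻²)`, `0 < η ≤ 7/(Γ log Γ)`, with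
`S₂ = (6/5)Rb√(Γ log Γ)` and forcing bound `M = (17/10)√Γ`: `Γ ≥ 10⁴`; `S₂ > 0`; bending budget
`η((47/10)(√Γ/5 + S₂) + M)S₂ ≤ 1/3000`; stability smallness `ηS₂((47/10)(√Γ/5 + 2S₂) + M) ≤ 1/2`; contraction
`2ηS₂·36√Γ ≤ 1/2`; curvature `η((47/10)(√Γ/5 + S₂) + M)√Γ ≤ 1`. [folklore] -/
theorem picard_constants {Γ Rb η : ℝ} (hRb0 : 0 < Rb) (hRb : Rb ≤ 1 / 500) (hΓ : Real.exp (1 / Rb ^ 2) ≤ Γ)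
    (hη0 : 0 < η) (hη : η * (Γ * Real.log Γ) ≤ 7) :
    (10 : ℝ) ^ 4 ≤ Γ ∧ 0 < 6 / 5 * (Rb * Real.sqrt (Γ * Real.log Γ)) ∧
    η * ((47 / 10) * (Real.sqrt Γ / 5 + 6 / 5 * (Rb * Real.sqrt (Γ * Real.log Γ))) + 17 / 10 * Real.sqrt Γ) *
        (6 / 5 * (Rb * Real.sqrt (Γ * Real.log Γ))) ≤ 1 / 3000 ∧
    η * (6 / 5 * (Rb * Real.sqrt (Γ * Real.log Γ))) *
        ((47 / 10) * (Real.sqrt Γ / 5 + 2 * (6 / 5 * (Rb * Real.sqrt (Γ * Real.log Γ)))) + 17 / 10 * Real.sqrt Γ) ≤ 1 / 2 ∧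
    2 * η * (6 / 5 * (Rb * Real.sqrt (Γ * Real.log Γ))) * (36 * Real.sqrt Γ) ≤ 1 / 2 ∧
    η * ((47 / 10) * (Real.sqrt Γ / 5 + 6 / 5 * (Rb * Real.sqrt (Γ * Real.log Γ))) + 17 / 10 * Real.sqrt Γ) *
        Real.sqrt Γ ≤ 1 := by
  have hRb2 : 250000 ≤ 1 / Rb ^ 2 := by
    rw [le_div_iff₀ (by positivity)]; nlinarith
  have hexp : 1 / Rb ^ 2 + 1 ≤ Real.exp (1 / Rb ^ 2) := Real.add_one_le_exp _
  have hΓ4 : (10 : ℝ) ^ 4 ≤ Γ := by linarith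
  have hΓ0 : 0 < Γ := by linarith
  set G : ℝ := Real.sqrt Γ with hGdef
  have hG : 0 < G := Real.sqrt_pos.2 hΓ0
  have hG2 : G ^ 2 = Γ := Real.sq_sqrt hΓ0.le
  set L : ℝ := Real.log Γ with hLdef
  have hL : 1 / Rb ^ 2 ≤ L := by
    have := Real.log_le_log (Real.exp_pos _) hΓ
    rwa [Real.log_exp] at this
  have hL0 : 0 < L := lt_of_lt_of_le (by positivity) hL
  set M : ℝ := Real.sqrt L with hMdef
  have hM : 0 < M := Real.sqrt_pos.2 hL0
  have hM2 : M ^ 2 = L := Real.sq_sqrt hL0.le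
  have hRbM : 1 ≤ Rb * M := by
    have h1 : 1 / Rb ≤ M := by
      rw [hMdef, ← Real.sqrt_sq (by positivity : (0:ℝ) ≤ 1 / Rb)]
      exact Real.sqrt_le_sqrt (by rw [div_pow, one_pow]; exact hL)
    have := mul_le_mul_of_nonneg_left h1 hRb0.le
    rwa [mul_one_div_cancel hRb0.ne'] at this
  have hGM : Real.sqrt (Γ * Real.log Γ) = G * M := by
    rw [hGdef, hMdef, hLdef, Real.sqrt_mul hΓ0.le]
  rw [hGM]
  have hK : η * G ^ 2 * M ^ 2 ≤ 7 := by rw [hG2, hM2]; simpa [mul_assoc] using hη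
  have hηG2 : η * G ^ 2 ≤ 7 * Rb ^ 2 := by
    have h1 : η * G ^ 2 ≤ η * G ^ 2 * (Rb * M) ^ 2 := by
      have : (1:ℝ) ≤ (Rb * M) ^ 2 := by nlinarith
      nlinarith [mul_pos hη0 (pow_pos hG 2)]
    nlinarith [h1, hK, sq_nonneg Rb]
  have hηGM : η * G ^ 2 * M ≤ 7 * Rb := by
    have h1 : η * G ^ 2 * M ≤ η * G ^ 2 * M * (Rb * M) := by
      have := mul_pos (mul_pos hη0 (pow_pos hG 2)) hM
      nlinarith
    nlinarith [h1, hK, hRb0]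
  set S₂ : ℝ := 6 / 5 * (Rb * (G * M)) with hS₂def
  have hA : η * G * S₂ ≤ 42 / 5 * Rb ^ 2 := by
    have : η * G * S₂ = 6 / 5 * Rb * (η * G ^ 2 * M) := by rw [hS₂def]; ring
    rw [this]; nlinarith [hηGM, hRb0]
  have hB : η * S₂ ^ 2 ≤ 252 / 25 * Rb ^ 2 := by
    have : η * S₂ ^ 2 = 36 / 25 * Rb ^ 2 * (η * G ^ 2 * M ^ 2) := by rw [hS₂def]; ring
    rw [this]; nlinarith [hK, sq_nonneg Rb]
  have hRb2' : Rb ^ 2 ≤ 1 / 250000 := by nlinarith [hRb0]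
  refine ⟨hΓ4, by positivity, ?_, ?_, ?_, ?_⟩
  · have : η * ((47 / 10) * (G / 5 + S₂) + 17 / 10 * G) * S₂ = 132 / 50 * (η * G * S₂) + 47 / 10 * (η * S₂ ^ 2) := by ring
    rw [this]; linarith [hA, hB, hRb2']
  · have : η * S₂ * ((47 / 10) * (G / 5 + 2 * S₂) + 17 / 10 * G) = 132 / 50 * (η * G * S₂) + 47 / 5 * (η * S₂ ^ 2) := by ring
    rw [this]; linarith [hA, hB, hRb2']
  · have : 2 * η * S₂ * (36 * G) = 72 * (η * G * S₂) := by ring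
    rw [this]; linarith [hA, hRb2']
  · have : η * ((47 / 10) * (G / 5 + S₂) + 17 / 10 * G) * G = 132 / 50 * (η * G ^ 2) + 47 / 10 * (η * G * S₂) := by ring
    rw [this]; linarith [hηG2, hA, hRb2']

/-- **RUNG 2, existence half: the cut-off local-induction arc with the TRUE `R_π`-partner field exists.**  See the module
docstring (Banach fixed point on unit tangent fields).  NOT an instance of `SelectionBoxRJ`; nothing about NS regularity or
blow-up. [folklore] -/
theorem truePartnerArc_exists {Γ Rb η : ℝ} (hRb0 : 0 < Rb) (hRb : Rb ≤ 1 / 500) (hΓ : Real.exp (1 / Rb ^ 2) ≤ Γ)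
    (hη0 : 0 < η) (hη : η * (Γ * Real.log Γ) ≤ 7) :
    ∃ (χ : ℝ → ℝ) (x : ℝ → EuclideanSpace ℝ (Fin 3)),
      ((∀ n : ℕ∞, ContDiff ℝ n χ) ∧ (∀ t, |t| ≤ 11 / 10 * (Rb * Real.sqrt (Γ * Real.log Γ)) → χ t = 1) ∧
        (∀ t, 6 / 5 * (Rb * Real.sqrt (Γ * Real.log Γ)) ≤ |t| → χ t = 0) ∧ (∀ t, 0 ≤ χ t ∧ χ t ≤ 1)) ∧
      (ContDiff ℝ 2 x ∧ x 0 = WithLp.toLp 2 ![Real.sqrt Γ / 5, 0, 0] ∧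
        deriv x 0 = WithLp.toLp 2 ![0, (Real.sqrt 2)⁻¹, (Real.sqrt 2)⁻¹] ∧ (∀ t, ‖deriv x t‖ = 1) ∧
        (∀ t, iteratedDeriv 2 x t = (η * χ t) • cross (deriv x t)
          ((1 / 2 : ℝ) • x t - (21 / 5 : ℝ) • cross (EuclideanSpace.single 2 1) (x t) +
            (Γ * 4 / (4 * Real.pi)) • ∫ σ : ℝ,
              ((‖x t - ((2 * ⟪x σ, EuclideanSpace.single 2 1⟫_ℝ) • (EuclideanSpace.single (2 : Fin 3) (1 : ℝ)) - x σ)‖ ^ 2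
                  + 1) ^ (3 / 2 : ℝ))⁻¹ •
                cross (deriv (fun u => (2 * ⟪x u, EuclideanSpace.single 2 1⟫_ℝ) •
                    (EuclideanSpace.single (2 : Fin 3) (1 : ℝ)) - x u) σ)
                  (x t - ((2 * ⟪x σ, EuclideanSpace.single 2 1⟫_ℝ) • (EuclideanSpace.single (2 : Fin 3) (1 : ℝ))
                    - x σ))))) ∧
      ((∀ t, ‖deriv x t - WithLp.toLp 2 ![0, (Real.sqrt 2)⁻¹, (Real.sqrt 2)⁻¹]‖ ≤ 1 / 3000) ∧
        (∀ t, ‖iteratedDeriv 2 x t‖ * Real.sqrt Γ ≤ 1) ∧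
        (∀ t, 6 / 5 * (Rb * Real.sqrt (Γ * Real.log Γ)) ≤ |t| → iteratedDeriv 2 x t = 0)) := by
  obtain ⟨hΓ4, hS₂0, hbend, hstab, hcontr, hcurvG⟩ := picard_constants hRb0 hRb hΓ hη0 hη
  have hΓ0 : 0 < Γ := by linarith [show (0:ℝ) < 10 ^ 4 by norm_num]
  have hG : 0 < Real.sqrt Γ := Real.sqrt_pos.2 hΓ0
  -- names
  obtain ⟨P, hP⟩ : ∃ P : EuclideanSpace ℝ (Fin 3), P = WithLp.toLp 2 ![Real.sqrt Γ / 5, 0, 0] := ⟨_, rfl⟩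
  obtain ⟨e, he⟩ : ∃ e : EuclideanSpace ℝ (Fin 3), e = WithLp.toLp 2 ![0, (Real.sqrt 2)⁻¹, (Real.sqrt 2)⁻¹] := ⟨_, rfl⟩
  have he1 : ‖e‖ = 1 := by rw [he]; exact norm_tangent₁
  have hPn : ‖P‖ = Real.sqrt Γ / 5 := by rw [hP]; exact norm_waist Γ hΓ0.le
  obtain ⟨S₂, hS₂⟩ : ∃ S₂ : ℝ, S₂ = 6 / 5 * (Rb * Real.sqrt (Γ * Real.log Γ)) := ⟨_, rfl⟩
  rw [← hS₂] at hS₂0 hbend hstab hcontr hcurvG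
  set e₃ : EuclideanSpace ℝ (Fin 3) := EuclideanSpace.single (2 : Fin 3) (1 : ℝ) with he₃
  -- the drift as a continuous linear map
  set A : EuclideanSpace ℝ (Fin 3) →L[ℝ] EuclideanSpace ℝ (Fin 3) :=
    (1 / 2 : ℝ) • ContinuousLinearMap.id ℝ (EuclideanSpace ℝ (Fin 3)) - (21 / 5 : ℝ) • crossCLM e₃ with hAdef
  have hA : ∀ y, A y = (1 / 2 : ℝ) • y - (21 / 5 : ℝ) • cross e₃ y := fun y => by simp [hAdef]
  -- the cut-off
  obtain ⟨χ, hχs, hχ1, hχ0, hχnn, hχle⟩ := exists_smooth_cutoff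
    (S₁ := 11 / 10 * (Rb * Real.sqrt (Γ * Real.log Γ))) (S₂ := S₂) (by rw [hS₂]; linarith)
  have hcc : Continuous (fun t => η * χ t) := continuous_const.mul (hχs 0).continuous
  have hcb : ∀ t, |η * χ t| ≤ η := fun t => by
    rw [abs_mul, abs_of_pos hη0, abs_of_nonneg (hχnn t)]; nlinarith [hχle t]
  have hc0 : ∀ t, S₂ ≤ |t| → η * χ t = 0 := fun t ht => by rw [hχ0 t ht, mul_zero]
  /- the objects attached to a unit tangent field `T` -/
  -- curve of a tangent field
  let zOf : (ℝ →ᵇ EuclideanSpace ℝ (Fin 3)) → ℝ → EuclideanSpace ℝ (Fin 3) := fun T t => P + ∫ u in (0:ℝ)..t, T u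
  -- the true partner forcing frozen along it
  let fOf : (ℝ →ᵇ EuclideanSpace ℝ (Fin 3)) → ℝ → EuclideanSpace ℝ (Fin 3) := fun T t =>
    (Γ * 4 / (4 * Real.pi)) • ∫ σ : ℝ,
      ((‖zOf T t - ((2 * ⟪zOf T σ, e₃⟫_ℝ) • e₃ - zOf T σ)‖ ^ 2 + 1) ^ (3 / 2 : ℝ))⁻¹ •
        cross (deriv (fun u => (2 * ⟪zOf T u, e₃⟫_ℝ) • e₃ - zOf T u) σ) (zOf T t - ((2 * ⟪zOf T σ, e₃⟫_ℝ) • e₃ - zOf T σ))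
  -- the admissible set of tangent fields
  set S : Set (ℝ →ᵇ EuclideanSpace ℝ (Fin 3)) := {T | ∀ t, ‖T t‖ = 1 ∧ ‖T t - e‖ ≤ 1 / 3000} with hSdef
  -- facts about `zOf T` for `T ∈ S`
  have hz : ∀ T ∈ S, ContDiff ℝ 1 (zOf T) ∧ zOf T 0 = P ∧ deriv (zOf T) = T ∧ (∀ u, ‖deriv (zOf T) u‖ = 1) ∧
      (∀ s, ‖deriv (zOf T) s - e‖ ≤ 1 / 3000) := by
    intro T hT
    obtain ⟨h1, h2, h3⟩ := tangentCurve_contDiff T.continuous P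
    exact ⟨h1, h2, h3, fun u => by rw [h3]; exact (hT u).1, fun s => by rw [h3]; exact (hT s).2⟩
  -- the frozen forcing: continuity and size
  have hf : ∀ T ∈ S, Continuous (fOf T) ∧ ∀ t, ‖fOf T t‖ ≤ 17 / 10 * Real.sqrt Γ := by
    intro T hT
    obtain ⟨h1, h2, -, h4, h5⟩ := hz T hT
    rw [hP] at h2; rw [he] at h5
    refine ⟨?_, fun t => ?_⟩
    · exact (partnerForcing_continuous (θ := 1 / 3000) hΓ0 (by norm_num) h1 (fun u => (h4 u).le) h2 h5).const_smul (Γ * 4 / (4 * Real.pi))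
    · exact partnerForcing_norm_le (θ := 1 / 3000) hΓ0 (by norm_num) (by norm_num) h1 h4 h2 h5 t
  -- the arc of `T`: THE cut-off local-induction solution forced by `fOf T`
  have hsol : ∀ T ∈ S, ∃ x : ℝ → EuclideanSpace ℝ (Fin 3), ContDiff ℝ 2 x ∧ x 0 = P ∧ deriv x 0 = e ∧
      (∀ t, ‖deriv x t‖ = 1) ∧ ∀ t, iteratedDeriv 2 x t = (η * χ t) • cross (deriv x t)
        ((1 / 2 : ℝ) • x t - (21 / 5 : ℝ) • cross e₃ (x t) + fOf T t) := by
    intro T hT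
    obtain ⟨x, hx, hx0, hx0', hunit, hode⟩ := cutoffLia_exists_cont hcc (hf T hT).1 A P he1
    exact ⟨x, hx, hx0, hx0', hunit, fun t => by rw [hode t, hA]⟩
  classical
  let xOf : (ℝ →ᵇ EuclideanSpace ℝ (Fin 3)) → ℝ → EuclideanSpace ℝ (Fin 3) := fun T =>
    if hT : T ∈ S then Classical.choose (hsol T hT) else fun _ => 0
  have hx : ∀ T (hT : T ∈ S), ContDiff ℝ 2 (xOf T) ∧ xOf T 0 = P ∧ deriv (xOf T) 0 = e ∧
      (∀ t, ‖deriv (xOf T) t‖ = 1) ∧ ∀ t, iteratedDeriv 2 (xOf T) t = (η * χ t) • cross (deriv (xOf T) t)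
        ((1 / 2 : ℝ) • xOf T t - (21 / 5 : ℝ) • cross e₃ (xOf T t) + fOf T t) := by
    intro T hT
    have : xOf T = Classical.choose (hsol T hT) := by simp [xOf, hT]
    rw [this]
    exact Classical.choose_spec (hsol T hT)
  -- bending of the arc: tangent within `1/3000` of `e`, curvature and straight arms
  have hxbend : ∀ T (hT : T ∈ S), (∀ t, ‖deriv (xOf T) t - e‖ ≤ 1 / 3000) ∧
      (∀ t, ‖iteratedDeriv 2 (xOf T) t‖ * Real.sqrt Γ ≤ 1) ∧ (∀ t, S₂ ≤ |t| → iteratedDeriv 2 (xOf T) t = 0) := by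
    intro T hT
    obtain ⟨h1, h2, h3, h4, h5⟩ := hx T hT
    obtain ⟨harm, hcurv, hb⟩ := cutoff_bending_le (M := 17 / 10 * Real.sqrt Γ) hη0.le hS₂0 (by positivity) h1 h4 h5 hcb
      hc0 (fun t _ => (hf T hT).2 t)
    rw [h2, hPn, h3] at hb
    rw [h2, hPn] at hcurv
    exact ⟨fun t => (hb t).trans hbend, fun t => (mul_le_mul_of_nonneg_right (hcurv t) hG.le).trans hcurvG, harm⟩
  /- the Picard map on `S` -/
  have hSclosed : IsClosed S := by
    have : S = ⋂ t : ℝ, ({T : ℝ →ᵇ EuclideanSpace ℝ (Fin 3) | ‖T t‖ = 1} ∩ {T | ‖T t - e‖ ≤ 1 / 3000}) := by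
      ext T; simp [hSdef]
    rw [this]
    refine isClosed_iInter fun t => IsClosed.inter ?_ ?_
    · exact isClosed_eq ((continuous_eval_const t).norm) continuous_const
    · exact isClosed_le ((continuous_eval_const t).sub continuous_const).norm continuous_const
  haveI : CompleteSpace S := hSclosed.completeSpace_coe
  have heS : BoundedContinuousFunction.const ℝ e ∈ S := fun t => by
    simp [he1]
  haveI : Nonempty S := ⟨⟨_, heS⟩⟩
  let Φ : S → S := fun T =>
    ⟨BoundedContinuousFunction.ofNormedAddCommGroup (deriv (xOf T.1))
        ((hx T.1 T.2).1.continuous_deriv (by norm_num)) 1 (fun t => ((hx T.1 T.2).2.2.2.1 t).le),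
      fun t => ⟨(hx T.1 T.2).2.2.2.1 t, (hxbend T.1 T.2).1 t⟩⟩
  have hΦapply : ∀ (T : S) (t : ℝ), ((Φ T : S) : ℝ →ᵇ EuclideanSpace ℝ (Fin 3)) t = deriv (xOf T.1) t := fun T t => rfl
  -- contraction
  have hLip : ∀ T₁ T₂ : S, dist (Φ T₁) (Φ T₂) ≤ (1 / 2 : ℝ) * dist T₁ T₂ := by
    intro T₁ T₂
    obtain ⟨hz₁c, hz₁0, hz₁d, hz₁u, hz₁e⟩ := hz T₁.1 T₁.2
    obtain ⟨hz₂c, hz₂0, hz₂d, hz₂u, hz₂e⟩ := hz T₂.1 T₂.2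
    obtain ⟨hx₁c, hx₁0, hx₁0', hx₁u, hx₁ode⟩ := hx T₁.1 T₁.2
    obtain ⟨hx₂c, hx₂0, hx₂0', hx₂u, hx₂ode⟩ := hx T₂.1 T₂.2
    have hδ0 : 0 ≤ dist T₁ T₂ := dist_nonneg
    have hδ : ∀ u, ‖deriv (zOf T₁.1) u - deriv (zOf T₂.1) u‖ ≤ dist T₁ T₂ := fun u => by
      rw [hz₁d, hz₂d, ← dist_eq_norm]
      exact BoundedContinuousFunction.dist_coe_le_dist u
    rw [hP] at hz₁0 hz₂0; rw [he] at hz₁e hz₂e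
    have hfd : ∀ t, ‖fOf T₁.1 t - fOf T₂.1 t‖ ≤ 36 * dist T₁ T₂ * Real.sqrt Γ := fun t =>
      partnerForcing_lipschitz (θ := 1 / 3000) hΓ0 (by norm_num) (by norm_num) hδ0 hz₁c hz₂c hz₁u hz₂u hz₁0 hz₂0
        hz₁e hz₂e hδ t
    have hst := cutoff_tangent_stability (M := 17 / 10 * Real.sqrt Γ) (ε := 36 * dist T₁ T₂ * Real.sqrt Γ) hη0.le hS₂0
      (by positivity) (by positivity) hx₁c hx₂c hx₁u hx₂u (hx₁0.trans hx₂0.symm) (hx₁0'.trans hx₂0'.symm) hx₁ode hx₂ode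
      hcb hc0 (fun t _ => (hf T₁.1 T₁.2).2 t) (fun t _ => hfd t) (by rw [hx₁0, hPn]; exact hstab)
    rw [Subtype.dist_eq]
    refine (BoundedContinuousFunction.dist_le (by positivity)).2 fun t => ?_
    rw [dist_eq_norm]
    show ‖deriv (xOf T₁.1) t - deriv (xOf T₂.1) t‖ ≤ 1 / 2 * dist (T₁ : ℝ →ᵇ EuclideanSpace ℝ (Fin 3)) T₂
    calc ‖deriv (xOf T₁.1) t - deriv (xOf T₂.1) t‖ ≤ 2 * η * S₂ * (36 * dist T₁ T₂ * Real.sqrt Γ) := hst t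
      _ = (2 * η * S₂ * (36 * Real.sqrt Γ)) * dist T₁ T₂ := by ring
      _ ≤ 1 / 2 * dist T₁ T₂ := mul_le_mul_of_nonneg_right hcontr hδ0
  have hK : ContractingWith ((1 : ℝ≥0) / 2) Φ := by
    refine ⟨NNReal.half_lt_self one_ne_zero, LipschitzWith.of_dist_le_mul fun T₁ T₂ => ?_⟩
    have : (((1 : ℝ≥0) / 2 : ℝ≥0) : ℝ) = 1 / 2 := by norm_num
    rw [this]; exact hLip T₁ T₂
  -- the fixed point
  set Tfix : S := ContractingWith.fixedPoint Φ hK with hTfix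
  have hfixed : Φ Tfix = Tfix := ContractingWith.fixedPoint_isFixedPt hK
  obtain ⟨hxc, hx0, hx0', hxu, hxode⟩ := hx Tfix.1 Tfix.2
  obtain ⟨hzc, hz0, hzd, hzu, hze⟩ := hz Tfix.1 Tfix.2
  have hderiv : ∀ t, deriv (xOf Tfix.1) t = (Tfix.1 : ℝ → EuclideanSpace ℝ (Fin 3)) t := fun t => by
    rw [← hΦapply Tfix t, hfixed]
  -- `z_T = x_T` by the fundamental theorem of calculus
  have hzx : zOf Tfix.1 = xOf Tfix.1 := by
    funext t
    show P + ∫ u in (0:ℝ)..t, (Tfix.1 : ℝ → EuclideanSpace ℝ (Fin 3)) u = xOf Tfix.1 t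
    have hxd : Differentiable ℝ (xOf Tfix.1) := hxc.differentiable (by norm_num)
    have hint := intervalIntegral.integral_eq_sub_of_hasDerivAt (a := 0) (b := t) (f := xOf Tfix.1)
      (f' := deriv (xOf Tfix.1)) (fun u _ => (hxd u).hasDerivAt)
      ((hxc.continuous_deriv (by norm_num)).intervalIntegrable _ _)
    have hcongr : ∫ u in (0:ℝ)..t, (Tfix.1 : ℝ → EuclideanSpace ℝ (Fin 3)) u = ∫ u in (0:ℝ)..t, deriv (xOf Tfix.1) u := by
      congr 1; funext u; rw [hderiv u]
    rw [hcongr, hint, hx0]; abel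
  obtain ⟨hb1, hb2, hb3⟩ := hxbend Tfix.1 Tfix.2
  refine ⟨χ, xOf Tfix.1, ⟨hχs, hχ1, fun t ht => hχ0 t (by rw [hS₂]; exact ht), fun t => ⟨hχnn t, hχle t⟩⟩,
    ⟨hxc, by rw [hx0, hP], by rw [hx0', he], hxu, fun t => ?_⟩,
    ⟨fun t => by rw [← he]; exact hb1 t, hb2, fun t ht => hb3 t (by rw [hS₂]; exact ht)⟩⟩
  have h := hxode t
  simp only [fOf, hzx] at h
  exact h

end SelectionBoxRJRung

end Summit.NavierStokesRegularity.NavierStokesRegularity.Theorems
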